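import Mathlib
import HarnessLib
import HarnessLib.Audit
import Summits.SmoothPoincare4.Statement
import Literature.Topology.FourManifolds.Trisections
import Literature.Topology.FourManifolds.ConnectedSum
import Literature.Topology.FourManifolds.ClosedBall
import HarnessLib.Audit.Status.Attr

/-!
Route: WeakReductionDescent

DORMANT since 2026-08-26T09:03:50Z (reconciler: no traction for 8.4 d (last activity item-evidence-added at 2026-08-17T23:03:27Z); parked, not closed — `ledger route dormant route-SmoothPoincare4-WeakReductionDescent --off` to reactivat) — unstaffed, not closed; items shared with open routes are served there. `ledger route dormant <id> --off` reactivates.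

# Route WeakReductionDescent — minimal trisections of a fake 4-sphere weakly reduce, then reduce —
SPC4 by descent on trisection genus

LENS strengthen-to-induct (cycle 2). S⁺ = a structural statement about MINIMAL-GENUS Gay–Kirby
trisections of homotopy 4-spheres,
proved rung by rung in the trisection genus g (the induction variable): X = MinimalWeaklyReducible ∧
WeakReductionReduces.
(K1) every minimal-genus (g; k₀,k₁,k₂) GK-trisection of genus g ≥ 3 of a smooth homotopy 4-sphere is
WEAKLY REDUCIBLE (Aranda–Zupan:
disjoint non-separating curves c, c′ on the central surface, c compressing in one handlebody, c′ in
the other two); (K2) a weakly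
reducible minimal trisection of genus g ≥ 4 is REDUCIBLE (an essential curve bounding discs in all
three handlebodies). The inductive
step is then a theorem-shaped support (ReducibleSplits: reducible ⇒ connected sum of two trisected
homotopy spheres of genus < g), the
base rungs are g ≤ 2 (Meier–Zupan / MSZ, tree fact mz_genus_le_two_homotopySphere_gk) and g = 3
(Aranda–Zupan 2025 Thm 1.3: weakly
reducible genus-3 trisections are standard; support GenusThreeBase), and `closes` is a strong
induction on g (26 lines, kernel-checked).
Realises card casson-gordon-one-dimension-up restricted, as its triage demands, to π₁ = 1 (M ≃ₕ S⁴,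
the Statement's own binders) and to minimal genus.
Lean: `MinimalWeaklyReducible ∧ WeakReductionReduces`

## Assembly
Strong induction on the genus g of a GK-trisection of the homotopy sphere M, stated over the
Statement's own bare binders
(M : Type, Hausdorff, second countable, C^∞ atlas modelled on ℝ⁴, e : M ≃ₕ S⁴). `closes` (rev 4,
route-repair unused-crux 2026-08-17,
kernel-checked rc 0 against the rev-3 module, standard axioms) takes TEN items as hypotheses and
first DERIVES crux K1
MinimalWeaklyReducible from its rungs through the glue item MinimalWeaklyReducibleOfRungs
(DependentTripleAtThree +
DependentTripleGenusThreeStandard carry rung 3 — Aranda–Zupan's dependent-triple certificate, Thm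
1.4 — and
MinimalWeaklyReducibleFromFour the rungs ≥ 4); K1 itself is no longer a hypothesis (it stays a crux
item, reached through the glue,
and becomes `derived` once the provable-now glue lands). Then rev 1–3's descent verbatim: unfold
SmoothPoincare4; TrisectionsExist gives
some trisection of genus g; if M has one of smaller genus, apply the induction hypothesis; otherwise
the trisection is minimal and
g ≤ 2 ⇒ LowGenusBase, g = 3 ⇒ K1 (weak reduction) + GenusThreeBase, g ≥ 4 ⇒ K1 +
WeakReductionReduces + ReducibleSplits give
homotopy-sphere summands A, B (bare binders + A ≃ₕ S⁴, B ≃ₕ S⁴) of genus < g, standard by induction,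
and SphereSumSphere closes.
Every binder occurs in the proof term. The Assembly ITEM keeps the K1-form (rev 1–3 `closes`
curried: provable now by that text) —
it records that a direct proof of K1 closes the route with GenusThreeBase and without the Thm 1.4
fact.

Rationale: WHY THIS LINE. Mechanism: Casson–Gordon's weak-reduction dichotomy for Heegaard splittings
(doi:10.1016/0166-8641(87)90092-7: weakly reducible ⇒
reducible or Haken) transplanted to trisections, where Aranda–Zupan (arXiv:2503.04607, Thm 1.3, Prop
3.9, §§5–6) have just made it work at
genus 3 (weakly reducible ⇒ reducible or a five-chain ⇒ Meier's list) with thin position, waves and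
Heegaard triples; the homotopy-sphere
hypothesis bites through χ = 2 ⇒ g = k₀+k₁+k₂ (every pairwise splitting is a STANDARD stabilised
splitting of #ᵏS¹×S², so cores exist in
all three pairs) and minimality excludes the stabilised/Property-R sectors. Imported area:
3-manifold Heegaard theory (disc complexes,
untelescoping, thin position). What no listed route does: GroupTrisection / CongruenceShadows attack
the STABLE algebraic avatar (AGK
(3k,k) group trisections, congruence quotients); SblfDescent descends SBLF genus via Hurwitz
systems; here the object is the unstable
minimal trisection and the move is geometric weak reduction — the (3;1,1,1) frontier of
LowGenusTrisectionBarrier is re-typed over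
the corrected predicate IsGKTrisection (GroupTrisection's (3;1,1,1) support item is stated over the
vacuous IsBalancedTrisection, C5).

RANKED CRUXES. #2 MinimalWeaklyReducible (crux) — for every smooth homotopy 4-sphere Σ and every
GK-trisection T of Σ of genus g ≥ 3 that is of minimal genus for Σ, T is weakly reducible: there are
disjoint non-separating smoothly embedded circles c, c′ on the central surface F = T₀∩T₁∩T₂ with c
bounding a properly embedded smooth disc in one handlebody ⋂_(l≠p) T_l and c′ bounding such discs in
the other two (card K1, restricted to π₁ = 1 and minimal genus). [difficulty: open-problem] (why it
might fail: shielded (SPC4-implied vacuously); the 3-D analogy points the other way (minimal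
splittings of hyperbolic 3-manifolds are strongly irreducible) and AZ25 Q8.3 names candidate
strongly irreducible genus-3 trisections (non-minimal, of S⁴/S_p); only minimality pushes toward
weak reduction.) [arXiv:2503.04607, doi:10.1016/0166-8641(87)90092-7, MeierSchirmerZupan2016,
arXiv:1708.01214]
#3 WeakReductionReduces (crux) — for every smooth homotopy 4-sphere Σ and every weakly reducible
GK-trisection T of Σ of genus g ≥ 4 that is of minimal genus for Σ, T is reducible: some smoothly
embedded circle δ on the central surface F, essential in F (bounding no embedded disc in F), bounds
properly embedded smooth discs in all three handlebodies (card K2 = Casson–Gordon one dimension up,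
restricted to π₁ = 1 and minimal genus). [deps: MinimalWeaklyReducible] [difficulty: open-problem]
(why it might fail: the 4-D Haken branch — untelescoping may end in relative trisections amalgamated
along a non-sphere separating 3-manifold Y ⊂ Σ (L(p,q)#L(p,−q), p odd, embeds in S⁴), irreducible
yet minimal; AZ25 control this only at g = 3 via five-chains, and the loop-surgery branch recurs at
every genus.) [arXiv:2503.04607, doi:10.1016/0166-8641(87)90092-7,
doi:10.1016/S0040-9383(00)00033-1, arXiv:1507.06561]
#4 DependentTripleAtThree (crux) — rung g = 3 of K1 re-typed as Aranda–Zupan's DEPENDENT TRIPLE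
(arXiv:2503.04607 Thm 1.4, §7): every minimal genus-3 GK-trisection of a smooth homotopy 4-sphere
(bare binders + e : M ≃ₕ S⁴; hence type (3;1,1,1)) carries pairwise disjoint non-separating smoothly
embedded circles a ⊂ H 0-disc, b ⊂ H 1-disc, c ⊂ H 2-disc whose union separates F; implied by K1 at
genus 3 (a weak reduction (c; c′) gives (c, c′, push-off of c′)) and strictly more permissive (§7
case (3)); in handle terms: every simply connected S¹×B³ ∪ two 2-handles with boundary S¹×S² is
S²×D² (stmt-17999; stub X₁ of K1's registered line rung_split). [difficulty: open-problem] (why it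
might fail: SPC4-shielded; mod AZ25 Thm 1.4 + LowGenusBase it is EQUIVALENT to the open (3;1,1,1)
frontier; without minimality it contains AZ25 Q8.3.) [arXiv:2503.04607, arXiv:1507.06561,
arXiv:1708.01214, MeierZupan2017]
#5 MinimalWeaklyReducibleFromFour (crux) — K1 VERBATIM FOR 4 ≤ g (stmt-18019; stub X₂ of line
rung_split): the part of K1 the descent consumes as a weak reduction (K2 starts at g ≥ 4). It is K1
minus rung 3 and shares K1's crux directory, ideas and lines — NOT to be staffed with a second
ideation chain while K1's runs (priority owner: key one chain, K1 → X₂ hand-over at the final-cycle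
formal split). [difficulty: open-problem] (why it might fail: as K1 — SPC4-shielded; no mechanism in
hand uses GLOBAL minimality, without which it is expected false (AZ25 Q8.3; minimal splittings of
hyperbolic 3-manifolds are strongly irreducible).) [arXiv:2503.04607,
doi:10.1016/0166-8641(87)90092-7, MeierSchirmerZupan2016, arXiv:1708.01214]
#9 ReducibleSplits (support) — the inductive step, theorem-shaped (Gay–Kirby §2 / MSZ §2 folklore +
van Kampen / Mayer–Vietoris): a GK-trisection of genus g of a smooth homotopy 4-sphere M (bare
binders + e : M ≃ₕ S⁴) that is reducible along an essential curve exhibits M as a connected sum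
(Literature IsConnectedSum, models 𝓡 4) A # B of two smooth homotopy 4-spheres A, B (bare binders +
homotopy equivalences to S⁴) carrying GK-trisections of genera < g (a non-separating tri-reducing
curve would give an S¹×S³ summand, excluded by π₁ = 1). [difficulty: XL — cutting along the reducing
2-sphere and recognising the pieces as homotopy spheres needs van Kampen + homology of connected
sums; nearest tree fact nonempty_homotopyEquiv_sphere_four_iff (SPC4Wave0, UNPROVED)] [GayKirby2016,
MeierSchirmerZupan2016, arXiv:2503.04607]
#9 GenusThreeBase (support) — rung g = 3, the homotopy-sphere corollary of Aranda–Zupan 2025 Thm 1.3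
over IsGKTrisection and the bare binders: a smooth homotopy 4-sphere with a weakly reducible genus-3
GK-trisection is diffeomorphic to S⁴ (weakly reducible genus-3 ⇒ reducible or five-chain ⇒ S_p,
S′_p, S⁴ or sums of ±CP², S¹×S³, S²×S²; the only homotopy sphere listed is S⁴). [difficulty:
named-fact grade — AZ25 Thm 1.3 is NOT yet vendored in Literature; closable only from that fact once
vendored and proved (needs-fact, cite item wanted)] [arXiv:2503.04607]
#9 LowGenusBase (support) — rungs g ≤ 2: a smooth homotopy 4-sphere with a GK-trisection of genus ≤
2 is diffeomorphic to S⁴ — the homotopy-sphere corollary of MSZ 2016 Thm 1.2 / MZ 2017 Thm 1.2 (χ =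
2 forces g = k₀+k₁+k₂, so every genus ≤ 2 type lies in the MSZ range kᵢ ≥ g − 1). [difficulty:
named-fact grade — it is, in kind, the tree's UNPROVED named fact
Literature.Barriers.SmoothPoincare4.mz_genus_le_two_homotopySphere_gk (itself implied by
msz_homotopySphere_gk: mz_genus_le_two_homotopySphere_gk_of_msz_alone,
LowGenusTrisectionsStandardProofs); closable when msz is proved (needs-fact)] [MeierZupan2017,
MeierSchirmerZupan2016, GayKirby2016]
#9 TrisectionsExist (support) — every smooth homotopy 4-sphere (bare binders) admits a
GK-trisection: Gay–Kirby Thm 4 is the PROVED tree theorem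
Literature.Topology.FourManifolds.exists_isBalancedGKTrisection_holds (TrisectionsProofs), fed with
CompactSpace (compactSpace_of_homotopyEquiv_sphere_four_holds), ConnectedSpace (transported from S⁴
along e) and a SmoothOrientation (isOrientable_of_homotopyEquiv_sphere_four_holds) — all proved.
[difficulty: provable-now, S] [GayKirby2016]
#9 SphereSumSphere (support) — a connected sum (IsConnectedSum, models 𝓡 4) of two smooth
4-manifolds each diffeomorphic to S⁴ is diffeomorphic to S⁴: transport along the diffeomorphisms of
the pieces, S⁴ admits an orientation-reversing diffeomorphism
(exists_diffeomorph_isOrientationReversing_sphere_holds), uniqueness of the oriented connected sum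
(ConnectedSumUniquenessProofs / ConnectedSumOrientedUniquenessProofs) and S⁴ # S⁴ ≅ S⁴
(isConnectedSum_sphere_self_holds); no homotopy-sphere hypothesis is needed. [difficulty:
provable-now, M/L] [KervaireMilnorAnnals1963, Kosinski1993]
#9 DependentTripleGenusThreeStandard (support) — Aranda–Zupan 2025 Thm 1.4 / Cor 1.5 (p. 2, §7 pp.
24–26), homotopy-sphere corollary over the bare binders: a smooth M ≃ₕ S⁴ with a genus-3
GK-trisection admitting a dependent triple is ≅ S⁴ (printed list S_p, S′_p, sums of ±CP², S²×S²; π₁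
= 1, H₂ = 0 leave S⁴) (stmt-18000; stub X_F). [difficulty: named-fact grade — vendor next to
az2025_weaklyReducible_genusThree_homotopySphere_gk and instantiate as
Theorems/WeakReductionDescentGenusThreeBase.lean does (needs-fact)] [arXiv:2503.04607]
#9 MinimalWeaklyReducibleOfRungs (support, GLUE, provable now) — DependentTripleAtThree →
DependentTripleGenusThreeStandard → MinimalWeaklyReducibleFromFour → MinimalWeaklyReducible
(stmt-18020): at g = 3 the dependent triple + Thm 1.4 give Φ : M ≅ S⁴ and Gay–Kirby's genus-0
trisection of S⁴ (sphere_genusZero_gkTrisection_holds, PROVED) pulled back along Φ⁻¹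
(IsGKTrisection.image_diffeomorph', PROVED) contradicts minimality, so rung 3 of K1 holds vacuously;
at g ≥ 4, X₂. PROVED sorry-free in the repair planner's Sketch.lean (rc 0, standard axioms; =
RungSplit.minimalWeaklyReducible_of_pieces of the registered skeleton) — a prover copies 12 lines
into Theorems/. It is the hypothesis through which `closes` (rev 4) reaches K1: the rung split of K1
armed by crux-strategist s1 (DECOMPOSITION.md on stmt-17907), filed as items because the formal
--split is final-cycle-only; exactness proved in the skeleton (K1 → X₂; K1 → GenusThreeBase → X₁),
so modulo AZ25 Thms 1.3/1.4 K1 ⇔ X₁ ∧ X₂. [difficulty: provable-now, S] [GayKirby2016,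
arXiv:2503.04607]
CONE (route-repair 2026-08-17). Every item is stated over the Statement's bare binders; imports are
Trisections (IsGKTrisection — its HasHandleDecomposition clause makes Handles/Morse/Cobordism
intrinsic), ConnectedSum (IsConnectedSum) and ClosedBall (the (𝓡∂ 2) disc vocabulary shared with
SchoenfliesTools / SurfaceCapping); HomotopySpheres is no longer imported (its unproved facts —
Smale's h-cobordism theorem isHCobordant_iff_nonempty_diffeomorph_of_five_le, the deprecated
exists_commGroup_homotopySphereClass — rode in only for the TYPE HomotopySphere 4) and the
bookkeeping item Spc4ReductionHomotopySphere is gone. Constant-level cone (#h21_route_deps): 34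
project constants, 0 unproved facts. The external theorems the line genuinely needs are carried
verbatim by the support items and recorded as needs-fact in the ledger note: msz_homotopySphere_gk /
mz_genus_le_two_homotopySphere_gk (LowGenusBase), Aranda–Zupan 2025 Thm 1.3 (GenusThreeBase, to be
vendored), and connected-sum homology / Whitehead (ReducibleSplits; cf.
nonempty_homotopyEquiv_sphere_four_iff). REV 4 (route-repair unused-crux 2026-08-17): `closes` now
takes X₁, X_F, X₂ and the glue as hypotheses instead of K1 (K1 reached through the glue: glue_used),
so every declared item except the bookkeeping Assembly lies in the cone of `closes`; imports
unchanged; #h21_route_deps re-checked by the gate at the edit.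

TWO-LAYER PLAN. FILED (rev 3–4, as items + glue, the formal --split being final-cycle-only):
MinimalWeaklyReducible ⇐ DependentTripleAtThree ∧
DependentTripleGenusThreeStandard ∧ MinimalWeaklyReducibleFromFour (glue
MinimalWeaklyReducibleOfRungs, proved); the tenure planner converts it into the
formal `--split MinimalWeaklyReducible` on a final cycle (children re-attach by normalised
signature; `--glue-by` the landed glue theorem) and may then
retire K1 in favour of X₂ + X₁. Still foreseen, not filed: DependentTripleAtThree ⇐ (core adjacency
for (3;1,1,1) / two attaching circles in S¹×S²,
AZ25 Q8.3 in minimal form); WeakReductionReduces ⇐ (dichotomy: weakly reducible minimal ⇒ reducible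
∨ loop-surgery on a genus < g
manifold X′ with rk π₁X′ ≤ (g+1)/3, AZ25 §5 generalised) → (the loop-surgery branch is non-minimal
for homotopy spheres; at g = 4 X′ is a
homotopy S¹×S³ of genus ≤ 3) → WeakReductionReduces.

KILL CRITERIA. Both cruxes are SPC4-shielded (BARRIERS §D.1): a refutation of either is an exotic
4-sphere of trisection genus ≥ 3 resp. ≥ 4 and closes
SPC4 itself (close --reason refuted:<Decl>). Soft kills that force a pivot: (i) a strongly
irreducible MINIMAL trisection of some closed
simply connected 4-manifold with g = b₂ + (k₀+k₁+k₂) found in print (the natural generalisation of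
K1 dies; pivot K1 to "weakly reducible
after one unbalanced stabilisation"); (ii) AZ25 Thm 1.3 failing referee (GenusThreeBase) — pivot the
g = 3 rung back to GroupTrisection's
(3;1,1,1) item. Mooted if SblfDescent or GroupTrisection closes SPC4.

NOT DECOMPOSED YET. The (3;1,1,1) core-adjacency lemma and its algebraic avatar (Whitehead-graph cut
vertices of core words, card K3), the loop-surgery
branch of the dichotomy at g ≥ 4, the relative (bordered) version needed if the Haken branch is
real, and the vendoring of AZ25 Thm 1.3
as a Literature named fact — all layer-2.

CHEAPEST FALSIFIER. Literature lookup (run 2026-08-17): does print already contain a strongly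
irreducible genus-3 trisection? AZ25 §8 (read p.27): NO —
Question 8.3 is open, with candidates (double branched covers of twist-spun 2-bridge knots, ≅ S⁴ or
S_p) that are NON-minimal, so they
miss K1 as typed. Next cheapest (refuter, one afternoon): check Meier's spun trisections of S(P³)
(arXiv:1708.01214, minimal (6;2,2,2)) for
weak reducibility — a strongly irreducible one kills the χ = 2 generalisation of K1 (not K1) and
tells the tenure planner the minimal-genus
restriction is load-bearing.

NUMBERS. Rungs: g ≤ 2 standard (MeierZupan2017 Thm 1.2, MeierSchirmerZupan2016 Thm 1.2; tree facts);
g = 3 weakly reducible ⇒ standard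
(arXiv:2503.04607 Thm 1.3, 2025); first open type (3;1,1,1); Chu–Tillmann g ≥ χ − 2 + 3 rk π₁ (S_p
minimal genus 3, irreducible for
p ≠ 0,1: AZ25 Lemma 2.7). Items at open: 9 (2 cruxes, 6 supports, assembly); after the cone repair
of 2026-08-17: 8 (2 cruxes, 5 supports, assembly; Spc4ReductionHomotopySphere dropped; the Assembly
item is `closes` curried and `closes` is the deciding theorem). Rev 3–4 (rung split filed,
2026-08-17): 12 items — 4 cruxes (K1 r2, K2 r3, DependentTripleAtThree r4,
MinimalWeaklyReducibleFromFour r5), 7 supports (2 closed: TrisectionsExist, SphereSumSphere; 1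
provable-now glue), assembly; `closes` has 10 hypotheses, all in its proof term; cone: 11/12 items
(all but Assembly).

DEFINITION REQUESTS. Cite fact wanted: Aranda–Zupan 2025 Thm 1.3 over
Literature.Topology.FourManifolds.IsGKTrisection (homotopy-sphere corollary =
GenusThreeBase) — to be filed as `--kind cite` after open. No new notion: weak reducibility /
reducibility are spelled out inline over
IsGKTrisection sectors, smooth circles 𝕊¹ → X and discs 𝔻² → X (Literature ClosedBall instances).

Novelty: Searches (2026-08-17): `lit search --source arxiv "weakly reducible trisections genus three
4-manifolds"` (1: arXiv:2503.04607, READ pp.1-2,6-7,27);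
ledger idea list SmoothPoincare4 (159 cards; spine casson-gordon-one-dimension-up graded variant by
refuter-24, nearest cards kneser-haken-one-dimension-up,
shadow-complexity-ladder, bott-width read); route files GroupTrisection, CongruenceShadows,
Stabilisation, SblfDescent read; `lean search` Trisections /
LowGenusTrisectionsStandard / WallStabilisation decls; lit searchd/galaxy sockets were resetting
during the session (recorded in NOTES.md) so no hybrid/galaxy pass.
Nearest prior art found: arXiv:2503.04607 (Aranda–Zupan 2025: weak reduction transplanted at genus
3, Q8.3) and MeierSchirmerZupan2016 / MeierZupan2017 (g ≤ 2,
kᵢ ≥ g−1); on the hub, route GroupTrisection's (3;1,1,1) support item and card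
casson-gordon-one-dimension-up (this route is its π₁ = 1, minimal-genus realisation).
Delta: the all-genus MINIMAL-genus weak-reduction descent for homotopy spheres, with the inductive
step isolated as a theorem-shaped support and the g = 3 rung discharged by AZ25, typed over the
corrected IsGKTrisection — AZ25's programme pointed at SPC4 one rung up.
Claimed grade: variant  [refs: 2503.04607, MeierSchirmerZupan2016, MeierZupan2017]

Barriers (technique_class: trisection-genus-descent, weak-reduction, heegaard-transplant): - technique_class: trisection-genus-descent, weak-reduction, heegaard-transplant
- Literature.Barriers.SmoothPoincare4.LowGenusTrisectionBarrier: evaded by construction — the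
descent starts at g = 3 with all kᵢ ≤ g − 2 (the barrier's first open type (3;1,1,1); its companion
LargeKTrisectionBarrier is why minimality is a usable hypothesis), and the g ≤ 2 / kᵢ ≥ g−1 theorems
enter only as base rungs.
- Literature.Barriers.SmoothPoincare4.HCobordismBarrierFour: not engaged (no h-cobordism or
stabilisation step); listed because every positive route cites it as non-applicable.
StrictPropertyTwoR (catalogued file PropertyTwoRAndrewsCurtis): restricting every statement to
MINIMAL-genus trisections says nothing about non-minimal trisections of S⁴, so the line implies
neither MSZ Conjecture 3.11 (4-D Waldhausen) nor stable Generalised Property R / Andrews–Curtis; the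
(g; k, g−k, 0) Property-R sectors enter only if minimal.
- Literature.Barriers.SmoothPoincare4.GaugeSumBarrierFour: no invariant is used, stable or otherwise
(StableBarrierFour likewise): no stabilisation (of manifold or trisection) is used; the avatar is
unstable, unlike AGK's.
- Literature.Barriers.SmoothPoincare4.HCobordismInvariantBarrierFour: it does not bite — no
invariant of the topological type is used; the bet is geometric (disc systems on the central
surface).
- Negatives index: empty for this summit at filing (ledger negatives --problem SmoothPoincare4: 0).

History (route lifecycle, newest last):
- 2026-08-17T05:02:18Z · rev 1: restated MinimalWeaklyReducible (stmt-SmoothPoincare4-17833), WeakReductionReduces (stmt-SmoothPoincare4-17834), ReducibleSplits (stmt-SmoothPoincare4-17835), GenusThreeBase (stmt-SmoothPoincare4-17836), LowGenusBase (stmt-SmoothPoincare4-17837), TrisectionsExist (stmt-SmoothPoincare4-17838), SphereSumSphere (st (planner-rrepair-SmoothPoincare4-WeakReductionD-1f212c3b-0)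
- 2026-08-17T05:02:18Z · rev 1: dropped Spc4ReductionHomotopySphere — route-repair (cone, rrepair-…-1f212c3b, 2026-08-17): RE-ROUTED AROUND the import-cone debt. Payload: 16 unproved cone facts, none named (unproved_cone_facts=[]; (planner-rrepair-SmoothPoincare4-WeakReductionD-1f212c3b-0)
- 2026-08-26T09:03:50Z · DORMANT — reconciler: no traction for 8.4 d (last activity item-evidence-added at 2026-08-17T23:03:27Z); parked, not closed — `ledger route dormant route-SmoothPoincare4- (operator:999:2834918)

sub-problem: SmoothPoincare4 · status: dormant · opened planner-plan-lens3-SmoothPoincare4-strengthen-g2-0 2026-08-17T04:31:49Z · rev 7 · ledger route-SmoothPoincare4-WeakReductionDescent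
GENERATED by the gate from the ledger (D-0016/17). Provers cite these decls: `theorem foo : Summit.SmoothPoincare4.SmoothPoincare4.Theses.WeakReductionDescent.<Decl> := …` in Summits/SmoothPoincare4/SmoothPoincare4/Theorems/<Name>.lean.
-/

namespace Summit.SmoothPoincare4.SmoothPoincare4.Theses.WeakReductionDescent

open scoped BigOperators Topology Manifold Classical MeasureTheory ProbabilityTheory Matrix InnerProductSpace ComplexConjugate ContinuousMap
open Filter Set Function TopologicalSpace MeasureTheory

attribute [summit_statement] _root_.SmoothPoincare4

open Literature.SPC4

-- earlier MinimalWeaklyReducible (stmt-SmoothPoincare4-17833, replaced 2026-08-17T05:02:18Z -> stmt-SmoothPoincare4-17907): retired by None — ∀ (S : Literature.Topology.FourManifolds.HomotopySphere 4) (g : ℕ) (k : Fin 3 → ℕ) (T : Fin 3 → Set S.carrier), Literature.Topology.FourManifolds.IsGKTrisection S.carrier g k T → 3 ≤ g → (∀ (g' : ℕ) (k' : Fin 3 → ℕ) (T' : Fin 3 → Set S.carrier), Literature.Top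
/-- item stmt-SmoothPoincare4-17907 · crux · rank 2 · open · by planner
why it might fail: shielded (SPC4-implied vacuously); the 3-D analogy points the other way (minimal splittings of hyperbolic 3-manifolds are strongly irreducible) and AZ25 Q8.3 names candidate strongly irreducible genus-3 trisections (non-minimal, of S⁴/S_p); only minimality pushes toward weak reduction.
sources: arXiv:2503.04607, doi:10.1016/0166-8641(87)90092-7, MeierSchirmerZupan2016, arXiv:1708.01214
[crux] for every smooth homotopy 4-sphere M — the Statement's own bare binders: M : Type, Hausdorff,
second countable, C^∞ atlas modelled on ℝ⁴, with a homotopy equivalence e : M ≃ₕ S⁴ (cone repair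
2026-08-17: no HomotopySphere packaging) — and every GK-trisection T of M of genus g ≥ 3 that is of
minimal genus for M, T is weakly reducible (Aranda–Zupan 2025, p. 6): there are disjoint
non-separating smoothly embedded circles c, c′ on the central surface F = T₀∩T₁∩T₂ with c bounding a
properly embedded smooth disc in one handlebody ⋂_(l≠p) T_l and c′ bounding such discs in the other
two (card K1, restricted to π₁ = 1 and minimal genus). [difficulty: open-problem] -/
@[route_item "route-SmoothPoincare4-WeakReductionDescent"]
def MinimalWeaklyReducible : Prop :=
  ∀ (M : Type) [TopologicalSpace M] [T2Space M] [SecondCountableTopology M] [ChartedSpace (EuclideanSpace ℝ (Fin 4)) M] [IsManifold (𝓡 4) ((⊤ : ℕ∞) : WithTop ℕ∞) M], (M ≃ₕ (Metric.sphere (0 : EuclideanSpace ℝ (Fin 5)) 1)) → ∀ (g : ℕ) (k : Fin 3 → ℕ) (T : Fin 3 → Set M), Literature.Topology.FourManifolds.IsGKTrisection M g k T → 3 ≤ g → (∀ (g' : ℕ) (k' : Fin 3 → ℕ) (T' : Fin 3 → Set M), Literature.Topology.FourManifolds.IsGKTrisection M g' k' T' → g ≤ g') → (let F : Set M := ⋂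 l, T l; let H : Fin 3 → Set M := fun p => ⋂ (l : Fin 3) (_ : l ≠ p), T l; let IsCurve : Set M → Prop := fun c => c ⊆ F ∧ ∃ γ : (Metric.sphere (0 : EuclideanSpace ℝ (Fin 2)) 1) → M, Manifold.IsSmoothEmbedding (𝓡 1) (𝓡 4) ((⊤ : ℕ∞) : WithTop ℕ∞) γ ∧ Set.range γ = c; let BoundsDisc : Set M → Set M → Prop := fun A c => ∃ d : (Metric.closedBall (0 : EuclideanSpace ℝ (Fin 2)) 1) → M, Manifold.IsSmoothEmbedding (𝓡∂ 2) (𝓡 4) ((⊤ : ℕ∞) : WithTop ℕ∞) d ∧ Set.range d ⊆ A ∧ d '' ((𝓡∂ 2).boundary (Metric.closedBall (0 : EuclideanSpace ℝ (Fin 2)) 1)) = c ∧ Set.range d ∩ F = c; let NonSep : Set M → Prop := fun c => IsConnected (F \ c); let WeaklyReducible : Prop := ∃ (p : Fin 3) (c c' : Set M), IsCurve c ∧ IsCurve c' ∧ Disjoint c c' ∧ NonSep c ∧ NonSep c' ∧ BoundsDisc (H p) c ∧ ∀ q : Fin 3, q ≠ p → BoundsDisc (H q) c'; WeaklyRedu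cible)

-- earlier WeakReductionReduces (stmt-SmoothPoincare4-17834, replaced 2026-08-17T05:02:18Z -> stmt-SmoothPoincare4-17908): retired by None — ∀ (S : Literature.Topology.FourManifolds.HomotopySphere 4) (g : ℕ) (k : Fin 3 → ℕ) (T : Fin 3 → Set S.carrier), Literature.Topology.FourManifolds.IsGKTrisection S.carrier g k T → 4 ≤ g → (∀ (g' : ℕ) (k' : Fin 3 → ℕ) (T' : Fin 3 → Set S.carrier), Literature.Topol
/-- item stmt-SmoothPoincare4-17908 · crux · rank 3 · open · by planner
why it might fail: the 4-D Haken branch — untelescoping may end in relative trisections amalgamated along a non-sphere separating 3-manifold Y ⊂ Σ (L(p,q)#L(p,−q), p odd, embeds in S⁴), irreducible yet minimal; AZ25 control this only at g = 3 via five-chains, and the loop-surgery branch recurs at every genus.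
sources: arXiv:2503.04607, doi:10.1016/0166-8641(87)90092-7, doi:10.1016/S0040-9383(00)00033-1, arXiv:1507.06561
[crux] for every smooth homotopy 4-sphere M (bare binders + e : M ≃ₕ S⁴) and every weakly reducible
GK-trisection T of M of genus g ≥ 4 that is of minimal genus for M, T is reducible: some smoothly
embedded circle δ on the central surface F, essential in F (bounding no embedded disc in F), bounds
properly embedded smooth discs in all three handlebodies (card K2 = Casson–Gordon one dimension up,
restricted to π₁ = 1 and minimal genus). [deps: MinimalWeaklyReducible] [difficulty: open-problem] -/
@[route_item "route-SmoothPoincare4-WeakReductionDescent", crux]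
def WeakReductionReduces : Prop :=
  ∀ (M : Type) [TopologicalSpace M] [T2Space M] [SecondCountableTopology M] [ChartedSpace (EuclideanSpace ℝ (Fin 4)) M] [IsManifold (𝓡 4) ((⊤ : ℕ∞) : WithTop ℕ∞) M], (M ≃ₕ (Metric.sphere (0 : EuclideanSpace ℝ (Fin 5)) 1)) → ∀ (g : ℕ) (k : Fin 3 → ℕ) (T : Fin 3 → Set M), Literature.Topology.FourManifolds.IsGKTrisection M g k T → 4 ≤ g → (∀ (g' : ℕ) (k' : Fin 3 → ℕ) (T' : Fin 3 → Set M), Literature.Topology.FourManifolds.IsGKTrisection M g' k' T' → g ≤ g') → (let F : Set M := ⋂ l, T l; let H : Fin 3 → Set M := fun p => ⋂ (l : Fin 3) (_ : l ≠ p), T l; let IsCurve : Set M → Prop := fun c => c ⊆ F ∧ ∃ γ : (Metric.sphere (0 : EuclideanSpace ℝ (Fin 2)) 1) → M, Manifold.IsSmoothEmbedding (𝓡 1) (𝓡 4) ((⊤ : ℕ∞) : WithTop ℕ∞) γ ∧ Set.range γ = c; let BoundsDisc : Set M → Set M → Prop := fun A c => ∃ d : (Metric.closedBall (0 : EuclideanSpace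 ℝ (Fin 2)) 1) → M, Manifold.IsSmoothEmbedding (𝓡∂ 2) (𝓡 4) ((⊤ : ℕ∞) : WithTop ℕ∞) d ∧ Set.range d ⊆ A ∧ d '' ((𝓡∂ 2).boundary (Metric.closedBall (0 : EuclideanSpace ℝ (Fin 2)) 1)) = c ∧ Set.range d ∩ F = c; let NonSep : Set M → Prop := fun c => IsConnected (F \ c); let WeaklyReducible : Prop := ∃ (p : Fin 3) (c c' : Set M), IsCurve c ∧ IsCurve c' ∧ Disjoint c c' ∧ NonSep c ∧ NonSep c' ∧ BoundsDisc (H p) c ∧ ∀ q : Fin 3, q ≠ p → BoundsDisc (H q) c'; WeaklyReducible) → (let F : Set M := ⋂ l, T l; let H : Fin 3 → Set M := fun p => ⋂ (l : Fin 3) (_ : l ≠ p), T l; let IsCurve : Set M → Prop := fun c => c ⊆ F ∧ ∃ γ : (Metric.sphere (0 : EuclideanSpace ℝ (Fin 2)) 1) → M, Manifold.IsSmoothEmbedding (𝓡 1) (𝓡 4) ((⊤ : ℕ∞) : WithTop ℕ∞) γ ∧ Set.range γ = c; let BoundsDisc : Set M → Set M → Prop := fun A c => ∃ d : (Metric.closedBall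 (0 : EuclideanSpace ℝ (Fin 2)) 1) → M, Manifold.IsSmoothEmbedding (𝓡∂ 2) (𝓡 4) ((⊤ : ℕ∞) : WithTop ℕ∞) d ∧ Set.range d ⊆ A ∧ d '' ((𝓡∂ 2).boundary (Metric.closedBall (0 : EuclideanSpace ℝ (Fin 2)) 1)) = c ∧ Set.range d ∩ F = c; let Reducible : Prop := ∃ δ : Set M, IsCurve δ ∧ ¬ (∃ e : (Metric.closedBall (0 : EuclideanSpace ℝ (Fin 2)) 1) → M, Manifold.IsSmoothEmbedding (𝓡∂ 2) (𝓡 4) ((⊤ : ℕ∞) : WithTop ℕ∞) e ∧ Set.range e ⊆ F ∧ e '' ((𝓡∂ 2).boundary (Metric.closedBall (0 : EuclideanSpace ℝ (Fin 2)) 1)) = δ) ∧ ∀ q : Fin 3, BoundsDisc (H q) δ; Reducible)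

/-- item stmt-SmoothPoincare4-17999 · crux · rank 4 · open · by planner
why it might fail: SPC4-shielded (vacuous under SPC4; a refutation is an exotic S4 of trisection genus 3); mod AZ25 Thm 1.4 + LowGenusBase it is EQUIVALENT to the open (3;1,1,1) frontier; without minimality it contains AZ25 Q8.3 (expected strongly irreducible (3;1)-trisections of S4).
sources: arXiv:2503.04607, arXiv:1507.06561, arXiv:1708.01214, MeierZupan2017
[crux] rung g = 3 of MinimalWeaklyReducible, re-typed as Aranda–Zupan's DEPENDENT TRIPLE
(arXiv:2503.04607 Thm 1.4, §7): for every smooth homotopy 4-sphere M (bare binders + e : M ≃ₕ S⁴)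
and every GK-trisection T of M of genus 3 that is of minimal genus for M (hence of type (3;1,1,1)),
there are pairwise disjoint non-separating smoothly embedded circles a, b, c on the central surface
F bounding properly embedded smooth discs in the three handlebodies H 0, H 1, H 2 respectively,
whose union separates F (for disjoint non-separating curves: [a],[b],[c] linearly dependent in H₁(F)
⇔ F minus (a ∪ b ∪ c) disconnected). Implied by K1 at genus 3 (a weak reduction (c; c′) gives (c,
c′, push-off of c′)) and strictly more permissive (AZ25 §7 case (3): a pants-cobounding triple is
not a weak reduction). In handle terms: every simply connected N = S¹×B³ ∪ two 2-handles with ∂N ≅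
S¹×S² is S²×D² — one 1-handle, so no Andrews–Curtis class intervenes. [deps: piece X1 of the
registered skeleton Lines/rung_split.lean of MinimalWeaklyReducible (stub_dependentTripleAtThree
verbatim); K1 at g=3 follows from it with DependentTripleGenusThreeStandard by the proved glue
minimalWeaklyReducible_of_pieces] [d -/
@[route_item "route-SmoothPoincare4-WeakReductionDescent", crux]
def DependentTripleAtThree : Prop :=
  ∀ (M : Type) [TopologicalSpace M] [T2Space M] [SecondCountableTopology M] [ChartedSpace (EuclideanSpace ℝ (Fin 4)) M] [IsManifold (𝓡 4) ((⊤ : ℕ∞) : WithTop ℕ∞) M], (M ≃ₕ (Metric.sphere (0 : EuclideanSpace ℝ (Fin 5)) 1)) → ∀ (k : Fin 3 → ℕ) (T : Fin 3 → Set M), Literature.Topology.FourManifolds.IsGKTrisection M 3 k T → (∀ (g' : ℕ) (k' : Fin 3 → ℕ) (T' : Fin 3 → Set M), Literature.Topology.FourManifolds.IsGKTrisection M g' k' T' → 3 ≤ g') → (let F : Set M := ⋂ l, T l; let H : Fin 3 → Set M := fun p => ⋂ (l : Fin 3) (_ : l ≠ p), T l; let IsCurve : Set M → Prop := fun c =>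 c ⊆ F ∧ ∃ γ : (Metric.sphere (0 : EuclideanSpace ℝ (Fin 2)) 1) → M, Manifold.IsSmoothEmbedding (𝓡 1) (𝓡 4) ((⊤ : ℕ∞) : WithTop ℕ∞) γ ∧ Set.range γ = c; let BoundsDisc : Set M → Set M → Prop := fun A c => ∃ d : (Metric.closedBall (0 : EuclideanSpace ℝ (Fin 2)) 1) → M, Manifold.IsSmoothEmbedding (𝓡∂ 2) (𝓡 4) ((⊤ : ℕ∞) : WithTop ℕ∞) d ∧ Set.range d ⊆ A ∧ d '' ((𝓡∂ 2).boundary (Metric.closedBall (0 : EuclideanSpace ℝ (Fin 2)) 1)) = c ∧ Set.range d ∩ F = c; let NonSep : Set M → Prop := fun c => IsConnected (F \ c); let DependentTriple : Prop := ∃ (a b c : Set M), IsCurve a ∧ IsCurve b ∧ IsCurve c ∧ Disjoint a b ∧ Disjoint b c ∧ Disjoint a c ∧ NonSep a ∧ NonSep b ∧ NonSep c ∧ BoundsDisc (H 0) a ∧ BoundsDisc (H 1) b ∧ BoundsDisc (H 2) c ∧ ¬ IsPreconnected (F \ (a ∪ b ∪ c)); DependentTriple)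

/-- item stmt-SmoothPoincare4-18019 · crux · rank 5 · open · by planner
why it might fail: As K1 (it is K1 minus rung 3): SPC4-shielded; no mechanism in hand uses GLOBAL minimality, without which it is expected false (AZ25 Q8.3 strongly irreducible candidates; 3-D analogy: minimal splittings of hyperbolic 3-manifolds are strongly irreducible); the Haken-type branch recurs at every genus.
sources: arXiv:2503.04607, doi:10.1016/0166-8641(87)90092-7, MeierSchirmerZupan2016, arXiv:1708.01214
[crux] child X₂ of the rung split of MinimalWeaklyReducible (K1) — K1 VERBATIM FOR 4 ≤ g
(stub_fromFour of the registered skeleton Lines/rung_split.lean): for every smooth homotopy 4-sphere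
M (bare binders + e : M ≃ₕ S⁴) and every GK-trisection T of M of genus g ≥ 4 that is of minimal
genus for M, T is weakly reducible (disjoint non-separating smoothly embedded circles c, c′ on the
central surface, c bounding a properly embedded smooth disc in one handlebody, c′ in the other two).
This is the part of K1 the route consumes AS A WEAK REDUCTION (crux K2 WeakReductionReduces starts
at g ≥ 4); rung 3 is carried by DependentTripleAtThree + DependentTripleGenusThreeStandard through
the proved glue (at g = 3 they give M ≅ S⁴, and the genus-0 trisection of S⁴ pulled back contradicts
minimality). The round-1 crux ideas on K1 (strong-haken-attaching-circles,
core-holes-one-sided-parity, core-traffic-whitehead, core-tunnel-handle-addition) apply verbatim.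
[difficulty: open-problem] [deps: child of MinimalWeaklyReducible — same lines, same crux directory;
do not staff a second ideation chain: every registered line of K1 restricted to g ≥ 4 is a line of
this item] -/
@[route_item "route-SmoothPoincare4-WeakReductionDescent", crux]
def MinimalWeaklyReducibleFromFour : Prop :=
  ∀ (M : Type) [TopologicalSpace M] [T2Space M] [SecondCountableTopology M] [ChartedSpace (EuclideanSpace ℝ (Fin 4)) M] [IsManifold (𝓡 4) ((⊤ : ℕ∞) : WithTop ℕ∞) M], (M ≃ₕ (Metric.sphere (0 : EuclideanSpace ℝ (Fin 5)) 1)) → ∀ (g : ℕ) (k : Fin 3 → ℕ) (T : Fin 3 → Set M), Literature.Topology.FourManifolds.IsGKTrisection M g k T → 4 ≤ g → (∀ (g' : ℕ) (k' : Fin 3 → ℕ) (T' : Fin 3 → Set M), Literature.Topology.FourManifolds.IsGKTrisection M g' k' T' → g ≤ g') → (let F : Set M := ⋂ l, T l; let H : Fin 3 → Set M := fun p => ⋂ (l : Fin 3) (_ : l ≠ p), T l; let IsCurve : Set M → Prop := fun c => c ⊆ F ∧ ∃ γ : (Metric.sphere (0 : EuclideanSpace ℝ (Fin 2)) 1) →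 M, Manifold.IsSmoothEmbedding (𝓡 1) (𝓡 4) ((⊤ : ℕ∞) : WithTop ℕ∞) γ ∧ Set.range γ = c; let BoundsDisc : Set M → Set M → Prop := fun A c => ∃ d : (Metric.closedBall (0 : EuclideanSpace ℝ (Fin 2)) 1) → M, Manifold.IsSmoothEmbedding (𝓡∂ 2) (𝓡 4) ((⊤ : ℕ∞) : WithTop ℕ∞) d ∧ Set.range d ⊆ A ∧ d '' ((𝓡∂ 2).boundary (Metric.closedBall (0 : EuclideanSpace ℝ (Fin 2)) 1)) = c ∧ Set.range d ∩ F = c; let NonSep : Set M → Prop := fun c => IsConnected (F \ c); let WeaklyReducible : Prop := ∃ (p : Fin 3) (c c' : Set M), IsCurve c ∧ IsCurve c' ∧ Disjoint c c' ∧ NonSep c ∧ NonSep c' ∧ BoundsDisc (H p) c ∧ ∀ q : Fin 3, q ≠ p → BoundsDisc (H q) c'; WeaklyReducible)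

/-- item stmt-SmoothPoincare4-19737 · crux · rank 7 · open · by planner
why it might fail: Safe in print (GK16 Lemma 13); AS TYPED the counts (1, k0, g−k1, k2, 1) need the induced genus-g splitting of ∂X0 ≅ #^k S¹×S² to be standard (Waldhausen 1968: unproved XL fact, its split child bounced twice) and IsSelfIndexing/criticalSetOfIndex conventions to match GK's collars.
sources: GayKirby2016, MeierSchirmerZupan2016, Waldhausen1968, LaudenbachPoenaruBSMF1972, MilnorHCobordism1965
[crux] Gay–Kirby 2016 Lemma 13 over the tree's IsGKTrisection — DEFINITIONALLY the Literature named
fact Literature.Topology.FourManifolds.gkTrisection_exists_isMorse_isSelfIndexing (a proof of this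
item discharges the fact by `rfl` transport): a closed connected oriented smooth 4-manifold with a
(g; k 0, k 1, k 2) GK-trisection carries a self-indexing Morse function with critical-point counts
(1, k 0, g − k 1, k 2, 1) by index (MSZ16 §4 Def 4.1 / Lemma 4.6 bookkeeping; χ = 2 + g − Σ k i).
PROMOTED TO CRUX by route-choice rchoice-…-4c94971c (2026-08-17): it was the XL apex of the landed
conditional proof of LowGenusBase (Theorems/WeakReductionDescentLowGenusBaseLeaves, p161251) and is
the trisection↔handle dictionary of the X₁ line
(Theorems/WeakReductionDescentDependentTripleAtThreeOfGtriMorse1121); with the supports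
PropertyRClosing + LaudenbachPoenaru it yields LowGenusBase through the provable-now glue
LowGenusBaseOfLeaves, so the g ≤ 2 rung becomes an interior node of `closes`. Natural split
(fact-file review): (a) X 0 ≅ ♮^{k 0} S¹×B³ as the 0∪1-handles (HasHandleDecomposition clause of
IsGKTrisection, in tree); (b) middle sector: the genus-g Heegaard splitting of ∂X 0 ≅ #^{k -/
@[route_item "route-SmoothPoincare4-WeakReductionDescent"]
def TrisectionHandles : Prop :=
  ∀ (X : Type) [TopologicalSpace X] [T2Space X] [SecondCountableTopology X] [ChartedSpace (EuclideanSpace ℝ (Fin 4)) X] [IsManifold (𝓡 4) ((⊤ : ℕ∞) : WithTop ℕ∞) X] [CompactSpace X] [ConnectedSpace X] (_ : Literature.Topology.FourManifolds.SmoothOrientation (𝓡 4) X) (g : ℕ) (k : Fin 3 → ℕ) (S : Fin 3 → Set X), Literature.Topology.FourManifolds.IsGKTrisection X g k S → ∃ f : X → ℝ, Literature.Topology.FourManifolds.IsMorse (𝓡 4) f ∧ Literature.Topology.FourManifolds.IsSelfIndexing (𝓡 4) f ∧ (Literature.Topology.FourManifolds.criticalSetOfIndex (𝓡 4) f 0).ncard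 = 1 ∧ (Literature.Topology.FourManifolds.criticalSetOfIndex (𝓡 4) f 1).ncard = k 0 ∧ (Literature.Topology.FourManifolds.criticalSetOfIndex (𝓡 4) f 2).ncard = g - k 1 ∧ (Literature.Topology.FourManifolds.criticalSetOfIndex (𝓡 4) f 3).ncard = k 2 ∧ (Literature.Topology.FourManifolds.criticalSetOfIndex (𝓡 4) f 4).ncard = 1

-- earlier GenusThreeBase (stmt-SmoothPoincare4-17836, replaced 2026-08-17T05:02:18Z -> stmt-SmoothPoincare4-17910): retired by None — ∀ (S : Literature.Topology.FourManifolds.HomotopySphere 4) (k : Fin 3 → ℕ) (T : Fin 3 → Set S.carrier), Literature.Topology.FourManifolds.IsGKTrisection S.carrier 3 k T → (let F : Set S.carrier := ⋂ l, T l; let H : Fin 3 → Set S.carrier := fun p => ⋂ (l : Fin 3) (_ : 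
/-- item stmt-SmoothPoincare4-17910 · crux · rank 9 · open · by planner
sources: arXiv:2503.04607
[support] rung g = 3, the homotopy-sphere corollary of Aranda–Zupan 2025 Thm 1.3 over IsGKTrisection
and the bare binders: a smooth homotopy 4-sphere with a weakly reducible genus-3 GK-trisection is
diffeomorphic to S⁴ (weakly reducible genus-3 ⇒ reducible or five-chain ⇒ S_p, S′_p, S⁴ or sums of
±CP², S¹×S³, S²×S²; the only homotopy sphere listed is S⁴). [difficulty: named-fact grade — AZ25 Thm
1.3 is not yet vendored in Literature; closable from that fact once vendored and proved
(needs-fact)] -/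
@[route_item "route-SmoothPoincare4-WeakReductionDescent", crux]
def GenusThreeBase : Prop :=
  ∀ (M : Type) [TopologicalSpace M] [T2Space M] [SecondCountableTopology M] [ChartedSpace (EuclideanSpace ℝ (Fin 4)) M] [IsManifold (𝓡 4) ((⊤ : ℕ∞) : WithTop ℕ∞) M], (M ≃ₕ (Metric.sphere (0 : EuclideanSpace ℝ (Fin 5)) 1)) → ∀ (k : Fin 3 → ℕ) (T : Fin 3 → Set M), Literature.Topology.FourManifolds.IsGKTrisection M 3 k T → (let F : Set M := ⋂ l, T l; let H : Fin 3 → Set M := fun p => ⋂ (l : Fin 3) (_ : l ≠ p), T l; let IsCurve : Set M → Prop := fun c => c ⊆ F ∧ ∃ γ : (Metric.sphere (0 : EuclideanSpace ℝ (Fin 2)) 1) → M, Manifold.IsSmoothEmbedding (𝓡 1) (𝓡 4) ((⊤ : ℕ∞) : WithTop ℕ∞) γ ∧ Set.range γ = c; let BoundsDisc : Set M → Set M → Prop := fun A c => ∃ d : (Metric.closedBall (0 : EuclideanSpace ℝ (Fin 2)) 1) → M, Manifold.IsSmoothEmbedding (𝓡∂ 2) (𝓡 4) ((⊤ : ℕ∞)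 : WithTop ℕ∞) d ∧ Set.range d ⊆ A ∧ d '' ((𝓡∂ 2).boundary (Metric.closedBall (0 : EuclideanSpace ℝ (Fin 2)) 1)) = c ∧ Set.range d ∩ F = c; let NonSep : Set M → Prop := fun c => IsConnected (F \ c); let WeaklyReducible : Prop := ∃ (p : Fin 3) (c c' : Set M), IsCurve c ∧ IsCurve c' ∧ Disjoint c c' ∧ NonSep c ∧ NonSep c' ∧ BoundsDisc (H p) c ∧ ∀ q : Fin 3, q ≠ p → BoundsDisc (H q) c'; WeaklyReducible) → Nonempty (Diffeomorph (𝓡 4) (𝓡 4) M (Metric.sphere (0 : EuclideanSpace ℝ (Fin 5)) 1) ((⊤ : ℕ∞) : WithTop ℕ∞))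

/-- item stmt-SmoothPoincare4-18000 · crux · rank 9 · open · by planner
why it might fail: AZ25 (arXiv:2503.04607) is an unrefereed 2025 preprint: Thm 1.4 (§7) rides on Thm 1.3's 18-page case analysis (Prop 3.9, Thm 4.8, Lemma 5.4/Prop 5.5, §6) + MZ17b + Chu–Tillmann; a gap reopens rung 3. SPC4-shielded (false only with an exotic S⁴); formally XL.
sources: arXiv:2503.04607, MeierZupan2017, MeierSchirmerZupan2016, doi:10.1016/0166-8641(87)90092-7
[support] Aranda–Zupan 2025 Thm 1.4 / Cor 1.5 (arXiv:2503.04607 p. 2, proof §7 pp. 24–26),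
homotopy-sphere corollary over the Statement's bare binders: a smooth M ≃ₕ S⁴ with a genus-3
GK-trisection admitting a dependent triple (as in DependentTripleAtThree) is diffeomorphic to S⁴ —
printed conclusion 'X is diffeomorphic to S_p, S′_p, or a connected sum of copies of ±CP² and
S²×S²'; π₁ = 1 and H₂ = 0 leave only S_1 = S′_1 = S⁴. Difficulty: named-fact grade — vendor
`arandaZupan_genus_three_dependentTriple_homotopySphere_gk` next to
`arandaZupan_genus_three_weaklyReducible_homotopySphere_gk` (WeaklyReducibleTrisections.lean) and
instantiate as Theorems/WeakReductionDescentGenusThreeBase.lean does for Thm 1.3 (needs-fact).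
[deps: piece X_F of the registered skeleton Lines/rung_split.lean of MinimalWeaklyReducible
(stub_dependentTripleStandard verbatim)] [difficulty: M once the AZ25 Thm 1.4 fact is vendored] -/
@[route_item "route-SmoothPoincare4-WeakReductionDescent", crux]
def DependentTripleGenusThreeStandard : Prop :=
  ∀ (M : Type) [TopologicalSpace M] [T2Space M] [SecondCountableTopology M] [ChartedSpace (EuclideanSpace ℝ (Fin 4)) M] [IsManifold (𝓡 4) ((⊤ : ℕ∞) : WithTop ℕ∞) M], (M ≃ₕ (Metric.sphere (0 : EuclideanSpace ℝ (Fin 5)) 1)) → ∀ (k : Fin 3 → ℕ) (T : Fin 3 → Set M), Literature.Topology.FourManifolds.IsGKTrisection M 3 k T → (let F : Set M := ⋂ l, T l; let H : Fin 3 → Set M := fun p => ⋂ (l : Fin 3) (_ : l ≠ p), T l; let IsCurve : Set M → Prop := fun c => c ⊆ F ∧ ∃ γ : (Metric.sphere (0 : EuclideanSpace ℝ (Fin 2)) 1) → M, Manifold.IsSmoothEmbedding (𝓡 1) (𝓡 4) ((⊤ : ℕ∞) : WithTop ℕ∞) γ ∧ Set.range γ = c; let BoundsDisc : Set M → Set M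 → Prop := fun A c => ∃ d : (Metric.closedBall (0 : EuclideanSpace ℝ (Fin 2)) 1) → M, Manifold.IsSmoothEmbedding (𝓡∂ 2) (𝓡 4) ((⊤ : ℕ∞) : WithTop ℕ∞) d ∧ Set.range d ⊆ A ∧ d '' ((𝓡∂ 2).boundary (Metric.closedBall (0 : EuclideanSpace ℝ (Fin 2)) 1)) = c ∧ Set.range d ∩ F = c; let NonSep : Set M → Prop := fun c => IsConnected (F \ c); let DependentTriple : Prop := ∃ (a b c : Set M), IsCurve a ∧ IsCurve b ∧ IsCurve c ∧ Disjoint a b ∧ Disjoint b c ∧ Disjoint a c ∧ NonSep a ∧ NonSep b ∧ NonSep c ∧ BoundsDisc (H 0) a ∧ BoundsDisc (H 1) b ∧ BoundsDisc (H 2) c ∧ ¬ IsPreconnected (F \ (a ∪ b ∪ c)); DependentTriple) → Nonempty (Diffeomorph (𝓡 4) (𝓡 4) M (Metric.sphere (0 : EuclideanSpace ℝ (Fin 5)) 1) ((⊤ : ℕ∞) : WithTop ℕ∞))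

/-- item stmt-SmoothPoincare4-18091 · support · rank 6 · open · by planner
[crux] Aranda–Zupan 2025 Thm 1.4 in DICHOTOMY form for homotopy spheres (route-choice 2026-08-17:
the AZ25 genus-3 classification is PROMOTED from the named-fact supports GenusThreeBase (= Thm 1.3
hs-corollary, XL fact az2025_weaklyReducible_genusThree_homotopySphere_gk) and
DependentTripleGenusThreeStandard (= Thm 1.4 hs-corollary verbatim), both now asides, to this ONE
crux, in the weakest form `closes` consumes): for every smooth homotopy 4-sphere M (bare binders + e
: M ≃ₕ S⁴) and every genus-3 GK-trisection T of M admitting a dependent triple (pairwise disjoint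
non-separating smoothly embedded circles a ⊂ H 0-disc, b ⊂ H 1-disc, c ⊂ H 2-disc on the central
surface F with F ∖ (a ∪ b ∪ c) disconnected — the block of DependentTripleAtThree), EITHER T is
reducible (an essential curve of F bounds properly embedded discs in all three handlebodies — the
block of ReducibleSplits; this branch is handed back to the route: ReducibleSplits + induction /
LowGenusBase + SphereSumSphere = AZ25 §6 p. 20 first paragraph) OR M ≅ S⁴ (AZ25: dependent triple &
irreducible ⇒ five-chain (Thm 1.4 first sentence; §7 pp. 24–26: cases (1),(2) are weak reductions
and go through Thm 1.3 / §6, case (3) bui -/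
@[route_item "route-SmoothPoincare4-WeakReductionDescent"]
def DependentTripleDichotomy : Prop :=
  ∀ (M : Type) [TopologicalSpace M] [T2Space M] [SecondCountableTopology M] [ChartedSpace (EuclideanSpace ℝ (Fin 4)) M] [IsManifold (𝓡 4) ((⊤ : ℕ∞) : WithTop ℕ∞) M], (M ≃ₕ (Metric.sphere (0 : EuclideanSpace ℝ (Fin 5)) 1)) → ∀ (k : Fin 3 → ℕ) (T : Fin 3 → Set M), Literature.Topology.FourManifolds.IsGKTrisection M 3 k T → (let F : Set M := ⋂ l, T l; let H : Fin 3 → Set M := fun p => ⋂ (l : Fin 3) (_ : l ≠ p), T l; let IsCurve : Set M → Prop := fun c => c ⊆ F ∧ ∃ γ : (Metric.sphere (0 : EuclideanSpace ℝ (Fin 2)) 1) → M, Manifold.IsSmoothEmbedding (𝓡 1) (𝓡 4) ((⊤ : ℕ∞) : WithTop ℕ∞) γ ∧ Set.range γ = c; let BoundsDisc : Set M → Set M → Prop := fun A c => ∃ d : (Metric.closedBall (0 : EuclideanSpace ℝ (Fin 2)) 1) → M, Manifold.IsSmoothEmbedding (𝓡∂ 2) (𝓡 4) ((⊤ : ℕ∞)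 : WithTop ℕ∞) d ∧ Set.range d ⊆ A ∧ d '' ((𝓡∂ 2).boundary (Metric.closedBall (0 : EuclideanSpace ℝ (Fin 2)) 1)) = c ∧ Set.range d ∩ F = c; let NonSep : Set M → Prop := fun c => IsConnected (F \ c); let DependentTriple : Prop := ∃ (a b c : Set M), IsCurve a ∧ IsCurve b ∧ IsCurve c ∧ Disjoint a b ∧ Disjoint b c ∧ Disjoint a c ∧ NonSep a ∧ NonSep b ∧ NonSep c ∧ BoundsDisc (H 0) a ∧ BoundsDisc (H 1) b ∧ BoundsDisc (H 2) c ∧ ¬ IsPreconnected (F \ (a ∪ b ∪ c)); DependentTriple) → (let F : Set M := ⋂ l, T l; let H : Fin 3 → Set M := fun p => ⋂ (l : Fin 3) (_ : l ≠ p), T l; let IsCurve : Set M → Prop := fun c => c ⊆ F ∧ ∃ γ : (Metric.sphere (0 : EuclideanSpace ℝ (Fin 2)) 1) → M, Manifold.IsSmoothEmbedding (𝓡 1) (𝓡 4) ((⊤ : ℕ∞) : WithTop ℕ∞) γ ∧ Set.range γ = c; let BoundsDisc : Set M → Set M → Prop := fun A c => ∃ d : (Metric.closedBall (0 : EuclideanSpace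 ℝ (Fin 2)) 1) → M, Manifold.IsSmoothEmbedding (𝓡∂ 2) (𝓡 4) ((⊤ : ℕ∞) : WithTop ℕ∞) d ∧ Set.range d ⊆ A ∧ d '' ((𝓡∂ 2).boundary (Metric.closedBall (0 : EuclideanSpace ℝ (Fin 2)) 1)) = c ∧ Set.range d ∩ F = c; let Reducible : Prop := ∃ δ : Set M, IsCurve δ ∧ ¬ (∃ e : (Metric.closedBall (0 : EuclideanSpace ℝ (Fin 2)) 1) → M, Manifold.IsSmoothEmbedding (𝓡∂ 2) (𝓡 4) ((⊤ : ℕ∞) : WithTop ℕ∞) e ∧ Set.range e ⊆ F ∧ e '' ((𝓡∂ 2).boundary (Metric.closedBall (0 : EuclideanSpace ℝ (Fin 2)) 1)) = δ) ∧ ∀ q : Fin 3, BoundsDisc (H q) δ; Reducible) ∨ Nonempty (Diffeomorph (𝓡 4) (𝓡 4) M (Metric.sphere (0 : EuclideanSpace ℝ (Fin 5)) 1) ((⊤ : ℕ∞) : WithTop ℕ∞))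

/-- item stmt-SmoothPoincare4-19941 · aside · rank 8 · open · by planner
[crux] Gay–Kirby 2016 Lemma 13 / Meier–Schirmer–Zupan 2016 §4 (Def 4.1, Lemma 4.6) HANDLE READING of
a trisection — the VERBATIM statement of the tree's unproved named fact
Literature.Topology.FourManifolds.gkTrisection_exists_isMorse_isSelfIndexing (definitionally equal,
`rfl`: folder bc/Rewire.lean, farm rc 0), PROMOTED to a route crux by route-choice
rchoice-…-3eb06a5b (2026-08-17; XL apex — provefact ×2 + split review could not land it and non-crux
facts are not split): for every closed connected oriented smooth 4-manifold X and every (g;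
k0,k1,k2) GK-trisection of X (IsGKTrisection, the corrected predicate, no standardness clause) there
is a self-indexing Morse function with exactly (1, k0, g−k1, k2, 1) critical points of index
(0,1,2,3,4). CONSUMERS (all downstream of the route file, hence not a `closes` binder — structural,
not decoration): (a) rung 3 — stub_factGKLemma13 of the registered line Lines/Sketch.lean of
DependentTripleAtThree (stmt-17999); its composition dependentTripleAtThree_of_gtriMorse1121
(p165900) takes THIS item as is: GKHandleReading → GroupTrisection.GtriMorse1121 (stmt-0435) →
DependentTripleAtThree (bc/Rewire.lean); (b) LowGenusBase (stmt-17911): LowG -/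
@[route_item "route-SmoothPoincare4-WeakReductionDescent"]
def GKHandleReading : Prop :=
  ∀ (X : Type) [TopologicalSpace X] [T2Space X] [SecondCountableTopology X] [ChartedSpace (EuclideanSpace ℝ (Fin 4)) X] [IsManifold (𝓡 4) ((⊤ : ℕ∞) : WithTop ℕ∞) X] [CompactSpace X] [ConnectedSpace X] (_ : Literature.Topology.FourManifolds.SmoothOrientation (𝓡 4) X) (g : ℕ) (k : Fin 3 → ℕ) (S : Fin 3 → Set X), Literature.Topology.FourManifolds.IsGKTrisection X g k S → ∃ f : X → ℝ, Literature.Topology.FourManifolds.IsMorse (𝓡 4) f ∧ Literature.Topology.FourManifolds.IsSelfIndexing (𝓡 4) f ∧ (Literature.Topology.FourManifolds.criticalSetOfIndex (𝓡 4) f 0).ncard = 1 ∧ (Literature.Topology.FourManifolds.criticalSetOfIndex (𝓡 4) f 1).ncard = k 0 ∧ (Literature.Topology.FourManifolds.criticalSetOfIndex (𝓡 4) f 2).ncard = g - k 1 ∧ (Literature.Topology.FourManifolds.criticalSetOfIndex (𝓡 4) f 3).ncard = k 2 ∧ (Literature.Topology.FourManifolds.criticalSetOfIndex (𝓡 4)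 f 4).ncard = 1

-- earlier ReducibleSplits (stmt-SmoothPoincare4-17835, replaced 2026-08-17T05:02:18Z -> stmt-SmoothPoincare4-17909): retired by None — ∀ (S : Literature.Topology.FourManifolds.HomotopySphere 4) (g : ℕ) (k : Fin 3 → ℕ) (T : Fin 3 → Set S.carrier), Literature.Topology.FourManifolds.IsGKTrisection S.carrier g k T → (let F : Set S.carrier := ⋂ l, T l; let H : Fin 3 → Set S.carrier := fun p => ⋂ (l : Fin
/-- item stmt-SmoothPoincare4-17909 · support · rank 9 · open · by planner
sources: GayKirby2016, MeierSchirmerZupan2016, arXiv:2503.04607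
[support] the inductive step, theorem-shaped (Gay–Kirby §2 / MSZ §2 folklore + van Kampen /
Mayer–Vietoris): a GK-trisection of genus g of a smooth homotopy 4-sphere M (bare binders + e : M ≃ₕ
S⁴) that is reducible along an essential curve exhibits M as a connected sum (Literature
IsConnectedSum, models 𝓡 4) of two smooth homotopy 4-spheres A, B (bare binders + homotopy
equivalences to S⁴, universe Type) carrying GK-trisections of genera < g (a non-separating
tri-reducing curve would give an S¹×S³ summand, excluded by π₁ = 1). [difficulty: XL — cutting along
the reducing 2-sphere and recognising the pieces as homotopy spheres needs van Kampen + homology of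
connected sums + Whitehead; nearest tree fact nonempty_homotopyEquiv_sphere_four_iff (UNPROVED)] -/
@[route_item "route-SmoothPoincare4-WeakReductionDescent", crux]
def ReducibleSplits : Prop :=
  ∀ (M : Type) [TopologicalSpace M] [T2Space M] [SecondCountableTopology M] [ChartedSpace (EuclideanSpace ℝ (Fin 4)) M] [IsManifold (𝓡 4) ((⊤ : ℕ∞) : WithTop ℕ∞) M], (M ≃ₕ (Metric.sphere (0 : EuclideanSpace ℝ (Fin 5)) 1)) → ∀ (g : ℕ) (k : Fin 3 → ℕ) (T : Fin 3 → Set M), Literature.Topology.FourManifolds.IsGKTrisection M g k T → (let F : Set M := ⋂ l, T l; let H : Fin 3 → Set M := fun p => ⋂ (l : Fin 3) (_ : l ≠ p), T l; let IsCurve : Set M → Prop := fun c => c ⊆ F ∧ ∃ γ : (Metric.sphere (0 : EuclideanSpace ℝ (Fin 2)) 1) → M, Manifold.IsSmoothEmbedding (𝓡 1) (𝓡 4) ((⊤ : ℕ∞) : WithTop ℕ∞) γ ∧ Set.range γ = c; let BoundsDisc : Set M → Set M → Prop := fun A c => ∃ d : (Metric.closedBall (0 : EuclideanSpace ℝ (Fin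 2)) 1) → M, Manifold.IsSmoothEmbedding (𝓡∂ 2) (𝓡 4) ((⊤ : ℕ∞) : WithTop ℕ∞) d ∧ Set.range d ⊆ A ∧ d '' ((𝓡∂ 2).boundary (Metric.closedBall (0 : EuclideanSpace ℝ (Fin 2)) 1)) = c ∧ Set.range d ∩ F = c; let Reducible : Prop := ∃ δ : Set M, IsCurve δ ∧ ¬ (∃ e : (Metric.closedBall (0 : EuclideanSpace ℝ (Fin 2)) 1) → M, Manifold.IsSmoothEmbedding (𝓡∂ 2) (𝓡 4) ((⊤ : ℕ∞) : WithTop ℕ∞) e ∧ Set.range e ⊆ F ∧ e '' ((𝓡∂ 2).boundary (Metric.closedBall (0 : EuclideanSpace ℝ (Fin 2)) 1)) = δ) ∧ ∀ q : Fin 3, BoundsDisc (H q) δ; Reducible) → ∃ (A : Type) (_ : TopologicalSpace A) (_ : T2Space A) (_ : SecondCountableTopology A) (_ : ChartedSpace (EuclideanSpace ℝ (Fin 4)) A) (_ : IsManifold (𝓡 4) ((⊤ : ℕ∞) : WithTop ℕ∞) A) (_ : A ≃ₕ (Metric.sphere (0 : EuclideanSpace ℝ (Fin 5)) 1)) (B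 : Type) (_ : TopologicalSpace B) (_ : T2Space B) (_ : SecondCountableTopology B) (_ : ChartedSpace (EuclideanSpace ℝ (Fin 4)) B) (_ : IsManifold (𝓡 4) ((⊤ : ℕ∞) : WithTop ℕ∞) B) (_ : B ≃ₕ (Metric.sphere (0 : EuclideanSpace ℝ (Fin 5)) 1)) (ga gb : ℕ) (ka kb : Fin 3 → ℕ) (TA : Fin 3 → Set A) (TB : Fin 3 → Set B), Literature.Topology.FourManifolds.IsGKTrisection A ga ka TA ∧ Literature.Topology.FourManifolds.IsGKTrisection B gb kb TB ∧ ga < g ∧ gb < g ∧ Literature.Topology.FourManifolds.IsConnectedSum (𝓡 4) (𝓡 4) (𝓡 4) A B M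

-- earlier LowGenusBase (stmt-SmoothPoincare4-17837, replaced 2026-08-17T05:02:18Z -> stmt-SmoothPoincare4-17911): retired by None — ∀ (S : Literature.Topology.FourManifolds.HomotopySphere 4) (g : ℕ) (k : Fin 3 → ℕ) (T : Fin 3 → Set S.carrier), Literature.Topology.FourManifolds.IsGKTrisection S.carrier g k T → g ≤ 2 → Nonempty (Diffeomorph (𝓡 4) (𝓡 4) S.carrier (Metric.sphere (0 : EuclideanSpace ℝ (F
/-- item stmt-SmoothPoincare4-17911 · support · rank 9 · open · by planner
sources: MeierZupan2017, MeierSchirmerZupan2016, GayKirby2016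
[support] rungs g ≤ 2: a smooth homotopy 4-sphere (bare binders + e : M ≃ₕ S⁴) with a GK-trisection
of genus ≤ 2 is diffeomorphic to S⁴ — the homotopy-sphere corollary of Meier–Schirmer–Zupan 2016 Thm
1.2 / Meier–Zupan 2017 Thm 1.2 (χ = 2 forces g = k₀+k₁+k₂, so every genus ≤ 2 type lies in the MSZ
range kᵢ ≥ g − 1). [difficulty: named-fact grade — in kind the tree's UNPROVED named fact
Literature.Barriers.SmoothPoincare4.mz_genus_le_two_homotopySphere_gk, implied by
msz_homotopySphere_gk (mz_genus_le_two_homotopySphere_gk_of_msz_alone); closable when msz is proved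
(needs-fact)] -/
@[route_item "route-SmoothPoincare4-WeakReductionDescent", crux]
def LowGenusBase : Prop :=
  ∀ (M : Type) [TopologicalSpace M] [T2Space M] [SecondCountableTopology M] [ChartedSpace (EuclideanSpace ℝ (Fin 4)) M] [IsManifold (𝓡 4) ((⊤ : ℕ∞) : WithTop ℕ∞) M], (M ≃ₕ (Metric.sphere (0 : EuclideanSpace ℝ (Fin 5)) 1)) → ∀ (g : ℕ) (k : Fin 3 → ℕ) (T : Fin 3 → Set M), Literature.Topology.FourManifolds.IsGKTrisection M g k T → g ≤ 2 → Nonempty (Diffeomorph (𝓡 4) (𝓡 4) M (Metric.sphere (0 : EuclideanSpace ℝ (Fin 5)) 1) ((⊤ : ℕ∞) : WithTop ℕ∞))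

-- earlier TrisectionsExist (stmt-SmoothPoincare4-17838, replaced 2026-08-17T05:02:18Z -> stmt-SmoothPoincare4-17912): retired by None — ∀ S : Literature.Topology.FourManifolds.HomotopySphere 4, ∃ (g : ℕ) (k : Fin 3 → ℕ) (T : Fin 3 → Set S.carrier), Literature.Topology.FourManifolds.IsGKTrisection S.carrier g k T
/-- item stmt-SmoothPoincare4-17912 · support · rank 9 · closed · proved by Summit.SmoothPoincare4.SmoothPoincare4.Theorems.TrisectionsExist_proof @ b5325d8714b8 (prover) · by planner
sources: GayKirby2016
[support] every smooth homotopy 4-sphere (bare binders + e : M ≃ₕ S⁴) admits a GK-trisection: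
Gay–Kirby Thm 4 is the PROVED tree theorem
Literature.Topology.FourManifolds.exists_isBalancedGKTrisection_holds, fed with CompactSpace
(compactSpace_of_homotopyEquiv_sphere_four_holds), ConnectedSpace (transported from S⁴ along e) and
a SmoothOrientation (isOrientable_of_homotopyEquiv_sphere_four_holds), all proved. [difficulty:
provable-now, S] -/
@[route_item "route-SmoothPoincare4-WeakReductionDescent", crux]
def TrisectionsExist : Prop :=
  ∀ (M : Type) [TopologicalSpace M] [T2Space M] [SecondCountableTopology M] [ChartedSpace (EuclideanSpace ℝ (Fin 4)) M] [IsManifold (𝓡 4) ((⊤ : ℕ∞) : WithTop ℕ∞) M], (M ≃ₕ (Metric.sphere (0 : EuclideanSpace ℝ (Fin 5)) 1)) → ∃ (g : ℕ) (k : Fin 3 → ℕ) (T : Fin 3 → Set M), Literature.Topology.FourManifolds.IsGKTrisection M g k T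

-- `TrisectionsExist` holds: proved by `Summit.SmoothPoincare4.SmoothPoincare4.Theorems.TrisectionsExist_proof` @ b5325d8714b8 (its module imports this route file, so no `_holds` link can be stated here).

-- earlier SphereSumSphere (stmt-SmoothPoincare4-17839, replaced 2026-08-17T05:02:18Z -> stmt-SmoothPoincare4-17913): retired by None — ∀ (S A B : Literature.Topology.FourManifolds.HomotopySphere 4), Literature.Topology.FourManifolds.IsConnectedSum (𝓡 4) (𝓡 4) (𝓡 4) A.carrier B.carrier S.carrier → Nonempty (Diffeomorph (𝓡 4) (𝓡 4) A.carrier (Metric.sphere (0 : EuclideanSpace ℝ (Fin 5)) 1) ((⊤ : ℕ∞) :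
/-- item stmt-SmoothPoincare4-17913 · support · rank 9 · closed · proved by Summit.SmoothPoincare4.SmoothPoincare4.Theorems.SphereSumSphere_proof @ b5325d8714b8 (prover) · by planner
sources: KervaireMilnorAnnals1963, Kosinski1993
[support] a connected sum (Literature IsConnectedSum, models 𝓡 4; A, B, M over the bare binders,
universe Type) of two smooth 4-manifolds A, B each diffeomorphic to S⁴ is diffeomorphic to S⁴:
transport along the diffeomorphisms of the pieces, S⁴ admits an orientation-reversing diffeomorphism
(exists_diffeomorph_isOrientationReversing_sphere_holds), uniqueness of the oriented connected sum
(ConnectedSumUniquenessProofs / ConnectedSumOrientedUniquenessProofs) and S⁴ # S⁴ ≅ S⁴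
(isConnectedSum_sphere_self_holds); no homotopy-sphere hypothesis is needed. [difficulty:
provable-now, M/L] -/
@[route_item "route-SmoothPoincare4-WeakReductionDescent", crux]
def SphereSumSphere : Prop :=
  ∀ (A : Type) [TopologicalSpace A] [T2Space A] [SecondCountableTopology A] [ChartedSpace (EuclideanSpace ℝ (Fin 4)) A] [IsManifold (𝓡 4) ((⊤ : ℕ∞) : WithTop ℕ∞) A] (B : Type) [TopologicalSpace B] [T2Space B] [SecondCountableTopology B] [ChartedSpace (EuclideanSpace ℝ (Fin 4)) B] [IsManifold (𝓡 4) ((⊤ : ℕ∞) : WithTop ℕ∞) B] (M : Type) [TopologicalSpace M] [T2Space M] [SecondCountableTopology M] [ChartedSpace (EuclideanSpace ℝ (Fin 4)) M] [IsManifold (𝓡 4) ((⊤ : ℕ∞) : WithTop ℕ∞) M], Literature.Topology.FourManifolds.IsConnectedSum (𝓡 4) (𝓡 4) (𝓡 4) A B M → Nonempty (Diffeomorph (𝓡 4) (𝓡 4) A (Metric.sphere (0 : EuclideanSpace ℝ (Fin 5)) 1) ((⊤ : ℕ∞) : WithTop ℕ∞)) → Nonempty (Diffeomorph (𝓡 4)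 (𝓡 4) B (Metric.sphere (0 : EuclideanSpace ℝ (Fin 5)) 1) ((⊤ : ℕ∞) : WithTop ℕ∞)) → Nonempty (Diffeomorph (𝓡 4) (𝓡 4) M (Metric.sphere (0 : EuclideanSpace ℝ (Fin 5)) 1) ((⊤ : ℕ∞) : WithTop ℕ∞))

-- `SphereSumSphere` holds: proved by `Summit.SmoothPoincare4.SmoothPoincare4.Theorems.SphereSumSphere_proof` @ b5325d8714b8 (its module imports this route file, so no `_holds` link can be stated here).

/-- item stmt-SmoothPoincare4-18020 · support · rank 9 · closed · proved by Summit.SmoothPoincare4.SmoothPoincare4.Theorems.MinimalWeaklyReducibleOfRungs_proof @ 37dfad46ec2e (prover) · by planner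
why it might fail: It cannot: pure logic over the route's own decls plus two PROVED tree theorems, kernel-checked in Sketch.lean against the current tree.
sources: GayKirby2016, arXiv:2503.04607
[support] GLUE of the rung split of K1 (route-repair unused-crux, 2026-08-17; the crux-strategist's
decomposition, DECOMPOSITION.md on stmt-SmoothPoincare4-17907): DependentTripleAtThree →
DependentTripleGenusThreeStandard → MinimalWeaklyReducibleFromFour → MinimalWeaklyReducible.
PROVABLE NOW — proved sorry-free (farm rc 0, axioms propext/Classical.choice/Quot.sound) as
`minimalWeaklyReducible_of_subs` in the repair planner's Sketch.lean (attached as evidence on this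
item) and as `RungSplit.minimalWeaklyReducible_of_pieces` in the registered skeleton
Cruxes/MinimalWeaklyReducible/Lines/rung_split.lean: at g = 3 the dependent triple (X₁) and AZ25 Thm
1.4 (X_F) give Φ : M ≅ S⁴, and Gay–Kirby's genus-0 trisection of S⁴
(Literature.Topology.FourManifolds.sphere_genusZero_gkTrisection_holds, PROVED) pulled back along
Φ⁻¹ (IsGKTrisection.image_diffeomorph', PROVED) contradicts minimality (3 ≤ 0), so rung 3 of K1
holds vacuously; at g ≥ 4, X₂ verbatim. A prover copies the 12-line proof into Theorems/ (extra
imports: Literature.Topology.FourManifolds.SphereTrisectionsSectors,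
Literature.Topology.FourManifolds.TrisectionFunctorGKNaturality). With this item the pieces X₁
(stmt-17999), X_F ( -/
@[route_item "route-SmoothPoincare4-WeakReductionDescent", crux]
def MinimalWeaklyReducibleOfRungs : Prop :=
  DependentTripleAtThree → DependentTripleGenusThreeStandard → MinimalWeaklyReducibleFromFour → MinimalWeaklyReducible

-- `MinimalWeaklyReducibleOfRungs` holds: proved by `Summit.SmoothPoincare4.SmoothPoincare4.Theorems.MinimalWeaklyReducibleOfRungs_proof` @ 37dfad46ec2e (its module imports this route file, so no `_holds` link can be stated here).

/-- item stmt-SmoothPoincare4-18096 · support · rank 9 · open · by planner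
[support] GLUE 2, provable now (route-choice rchoice-…-1ae5b79e, 2026-08-17):
DependentTripleDichotomy → ReducibleSplits → LowGenusBase → SphereSumSphere →
DependentTripleGenusThreeStandard. The verbatim AZ25 Thm 1.4 item X_F (stmt-18000, promoted to crux
by seat rchoice-…-377cd79d) is DERIVED from the dichotomy crux DependentTripleDichotomy (stmt-18091,
the weakest AZ25 statement the descent needs) and the route's own reducible-branch items: given a
genus-3 GK-trisection of a homotopy sphere with a dependent triple, the dichotomy yields a reducing
curve — then ReducibleSplits splits M = A # B into GK-trisected homotopy spheres of genus < 3,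
LowGenusBase makes both ≅ S⁴, SphereSumSphere gives M ≅ S⁴ — or M ≅ S⁴ outright; NO minimality is
needed. PROVED sorry-free in the planner's Sketch.lean (`dependentTripleStandardOfDichotomy_proof`,
10 lines, farm rc 0, axioms propext/Classical.choice/Quot.sound); a prover copies it into Theorems/
(import the route file only). PURPOSE: consumed by `closes` (design M′, certified as `closesM2` in
Sketch.lean: `have hXF := hG2 hD h3 h5 h7`, then rev-5 descent) so that X_F becomes an interior node
(glue_used) and the only open AZ25 leaf of the cone -/
@[route_item "route-SmoothPoincare4-WeakReductionDescent"]
def DependentTripleStandardOfDichotomy : Prop :=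
  DependentTripleDichotomy → ReducibleSplits → LowGenusBase → SphereSumSphere → DependentTripleGenusThreeStandard

/-- item stmt-SmoothPoincare4-19931 · support · rank 9 · open · by planner
why it might fail: True in print (Gabai 1987 Cor 8.3 ⇒ GST 2010 Prop 9.2); as typed it can only fail through the tree's HasHandleDecomposition/BoundaryData/IsBoundaryGluing conventions — item = Literature fact propertyR_exists_isBoundaryGluing_sphere_four by rfl.
sources: GompfScharlemannThompson2010, GabaiJDG1987, Kirby1989
[support] Property R closing in 4-dimensional handle form — DEFINITIONALLY the Literature named fact
Literature.Topology.FourManifolds.propertyR_exists_isBoundaryGluing_sphere_four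
(PropertyRTraceClosing.lean; GST 2010 Thm 1.1 with Prop 9.2 for one 2-handle / Gabai 1987 Cor 8.3 /
Kirby 1989 Ch. I §2; `rfl` in the planner's Sketch.lean): a compact 4-manifold P with a (1 zero-, 0
one-, 1 two-handle) decomposition whose boundary is diffeomorphic to the boundary of some compact
connected orientable (1,1)-handlebody (so ∂P ≅ S¹×S²) closes up, by a compact connected orientable
(1,1)-handlebody V′ glued along some φ′, to the round S⁴. Route role (route-choice
rchoice-…-4c94971c, 2026-08-17): second leaf of the g ≤ 2 rung — slice (2;1,1,0): cut the
GK-Lemma-13 Morse function at level 5/2, M = (B⁴ ∪ h²) ∪ (h³ ∪ h⁴) — consumed by the glue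
LowGenusBaseOfLeaves. Closable when the fact is proved: the Literature file already reduces it
(propertyR_exists_isBoundaryGluing_sphere_four_of_leaves) to Gabai's Cor 8.3 (gabai_propertyR), 'a
knot bounding a disc is trivial' and two handle-theory facts; `theorem PropertyRClosing_holds`
discharges item and fact at once. Why it might fail: not as mathematic -/
@[route_item "route-SmoothPoincare4-WeakReductionDescent"]
def PropertyRClosing : Prop :=
  ∀ (P : Type) [TopologicalSpace P] [T2Space P] [SecondCountableTopology P] [ChartedSpace (EuclideanHalfSpace 4) P] [IsManifold (𝓡∂ 4) ((⊤ : ℕ∞) : WithTop ℕ∞) P] [CompactSpace P], Literature.Topology.FourManifolds.HasHandleDecomposition 3 P (fun k => if k = 0 then 1 else if k = 2 then 1 else 0) → ∀ (bP : Literature.Topology.FourManifolds.BoundaryData (𝓡∂ 4) P (𝓡 3)), (∃ (V : Type) (_ : TopologicalSpace V) (_ : T2Space V) (_ : SecondCountableTopology V) (_ : ChartedSpace (EuclideanHalfSpace 4) V) (_ : IsManifold (𝓡∂ 4) ((⊤ : ℕ∞) : WithTop ℕ∞) V) (_ : CompactSpace V) (_ : ConnectedSpace V) (bV : Literature.Topology.FourManifolds.BoundaryData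 (𝓡∂ 4) V (𝓡 3)), Literature.Topology.FourManifolds.HasHandleDecomposition 3 V (Literature.Topology.FourManifolds.handleCount 1 1) ∧ Literature.Topology.FourManifolds.IsOrientable (𝓡∂ 4) V ∧ Nonempty (Diffeomorph (𝓡 3) (𝓡 3) bP.carrier bV.carrier ((⊤ : ℕ∞) : WithTop ℕ∞))) → ∃ (V' : Type) (_ : TopologicalSpace V') (_ : T2Space V') (_ : SecondCountableTopology V') (_ : ChartedSpace (EuclideanHalfSpace 4) V') (_ : IsManifold (𝓡∂ 4) ((⊤ : ℕ∞) : WithTop ℕ∞) V') (_ : CompactSpace V') (_ : ConnectedSpace V') (bV' : Literature.Topology.FourManifolds.BoundaryData (𝓡∂ 4) V' (𝓡 3)) (φ' : Diffeomorph (𝓡 3) (𝓡 3) bP.carrier bV'.carrier ((⊤ : ℕ∞) : WithTop ℕ∞)), Literature.Topology.FourManifolds.HasHandleDecomposition 3 V' (Literature.Topology.FourManifolds.handleCount 1 1) ∧ Literature.Topology.FourManifolds.IsOrientable (𝓡∂ 4) V' ∧ Literature.Topology.FourManifolds.IsBoundaryGluing bP bV' φ' (𝓡 4) (Metric.sphere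 (0 : EuclideanSpace ℝ (Fin 5)) 1)

/-- item stmt-SmoothPoincare4-19932 · support · rank 9 · open · by planner
why it might fail: True in print (Laudenbach–Poénaru 1972; GS99 §4.4); as typed it can only fail through IsHandlebodyOfIndexLE 3 1 / IsOrientable / BoundaryData conventions — item = exists_diffeomorph_comp_incl_eq.{0} by rfl.
sources: LaudenbachPoenaruBSMF1972, GompfStipsicz1999, CerfDiffeoSphere1968
[support] Laudenbach–Poénaru 1972 extension theorem, at universe 0 — DEFINITIONALLY
Literature.Topology.FourManifolds.exists_diffeomorph_comp_incl_eq.{0} (SPC4Handles.lean (c); `rfl`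
in the planner's Sketch.lean): every self-diffeomorphism ψ of the boundary of a compact connected
orientable 4-dimensional 1-handlebody V (≅ ♮k S¹×B³) extends to a self-diffeomorphism Ψ of V with Ψ
∘ incl = incl ∘ ψ. Route role (route-choice rchoice-…-4c94971c): third leaf of the g ≤ 2 rung —
slice (g; g,0,0): the Morse function has two critical points, M is a twisted sphere, ≅ S⁴ by Cerf's
Γ₄ = 0, which the tree PROVES from this fact
(cerf_twistedSphere_four_of_exists_diffeomorph_comp_incl_eq); slice (2;1,1,0): uniqueness of the
(1,1)-handlebody closing — consumed by the glue LowGenusBaseOfLeaves. XL to formalise (LP's proof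
rests on Laudenbach's 3-dimensional isotopy theorems; GS99 §4.4); closable when the fact is proved,
`theorem LaudenbachPoenaru_holds` discharging item and fact at once. Why it might fail: not as
mathematics; as typed only through IsHandlebodyOfIndexLE 3 1 / BoundaryData conventions. sources:
LaudenbachPoenaruBSMF1972, GompfStipsicz1999, CerfDiffeoSphere1968. -/
@[route_item "route-SmoothPoincare4-WeakReductionDescent"]
def LaudenbachPoenaru : Prop :=
  ∀ (V : Type) [TopologicalSpace V] [T2Space V] [SecondCountableTopology V] [CompactSpace V] [ConnectedSpace V] [ChartedSpace (EuclideanHalfSpace 4) V] [IsManifold (𝓡∂ 4) ((⊤ : ℕ∞) : WithTop ℕ∞) V] (hV : Literature.Topology.FourManifolds.IsHandlebodyOfIndexLE 3 1 V) (ho : Literature.Topology.FourManifolds.IsOrientable (𝓡∂ 4) V) (b : Literature.Topology.FourManifolds.BoundaryData (𝓡∂ 4) V (𝓡 3)) (φ : Diffeomorph (𝓡 3) (𝓡 3) b.carrier b.carrier ((⊤ : ℕ∞) : WithTop ℕ∞)), ∃ Φ : Diffeomorph (𝓡∂ 4) (𝓡∂ 4) V V ((⊤ : ℕ∞) : WithTop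 ℕ∞), ⇑Φ ∘ b.incl = b.incl ∘ ⇑φ

/-- item stmt-SmoothPoincare4-19933 · support · rank 9 · open · by planner
why it might fail: It cannot: `fun h13 hR hLP => Summit.SmoothPoincare4.SmoothPoincare4.Theorems.LowGenusBase_of_gkLemma13_of_propertyR_of_laudenbachPoenaru h13 hR hLP` proves it (kernel-checked in the planner's Sketch.lean against rev 4 + verbatim item copies).
sources: GayKirby2016, MeierSchirmerZupan2016, GompfScharlemannThompson2010
[support] GLUE 3, provable now — TrisectionHandles → PropertyRClosing → LaudenbachPoenaru →
LowGenusBase (route-choice rchoice-…-4c94971c, 2026-08-17: the XL apex fact GK Lemma 13 of the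
landed conditional proof of LowGenusBase was PROMOTED to the crux TrisectionHandles; this glue makes
the g ≤ 2 rung LowGenusBase — stmt-17911, ≡ mz_genus_le_two_homotopySphere_gk, eight prover passes
blocked on that opaque MSZ fact — an interior node whose open leaves are GK Lemma 13, Property R and
Laudenbach–Poénaru). PROOF (one line, kernel-checked in the planner's Sketch.lean as
lowGenusBaseOfLeaves_proof, axioms propext/Classical.choice/Quot.sound): `theorem
LowGenusBaseOfLeaves_holds' : LowGenusBaseOfLeaves := fun h13 hR hLP =>
Summit.SmoothPoincare4.SmoothPoincare4.Theorems.LowGenusBase_of_gkLemma13_of_propertyR_of_laudenbachPoenaru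
h13 hR hLP` in a Theorems file importing the route file and
Summits.SmoothPoincare4.SmoothPoincare4.Theorems.WeakReductionDescentLowGenusBaseLeaves (p161251;
the three item bodies are syntactically the three hypotheses of that theorem). Mathematics inside
the landed theorem: χ = 2 forces g = k 0 + k 1 + k 2 (LowGenusBase_iff_cases), leaving slice (g;
g,0,0) — rel -/
@[route_item "route-SmoothPoincare4-WeakReductionDescent"]
def LowGenusBaseOfLeaves : Prop :=
  TrisectionHandles → PropertyRClosing → LaudenbachPoenaru → LowGenusBase

-- earlier Assembly (stmt-SmoothPoincare4-17841, replaced 2026-08-17T05:02:18Z -> stmt-SmoothPoincare4-17914): retired by None — MinimalWeaklyReducible → WeakReductionReduces → ReducibleSplits → GenusThreeBase → LowGenusBase → TrisectionsExist → SphereSumSphere → Spc4ReductionHomotopySphere → SmoothPoincare4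
/-- item stmt-SmoothPoincare4-17914 · assembly · rank 1 · open · by planner
sources: GayKirby2016, arXiv:2503.04607
[assembly] MinimalWeaklyReducible → WeakReductionReduces → ReducibleSplits → GenusThreeBase →
LowGenusBase → TrisectionsExist → SphereSumSphere → SmoothPoincare4 (exactly `closes` curried: the
deciding theorem `closes` proves it outright; kept because an assembly item cannot be dropped). -/
@[route_item "route-SmoothPoincare4-WeakReductionDescent"]
def Assembly : Prop :=
  MinimalWeaklyReducible → WeakReductionReduces → ReducibleSplits → GenusThreeBase → LowGenusBase → TrisectionsExist → SphereSumSphere → SmoothPoincare4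

/-! D-0027 §2.1 — DECIDING THEOREM (planner-authored via `route open/edit --closes-file`; by planner-rrepair-SmoothPoincare4-WeakReductionD-d4552491-0 2026-08-17T10:37:48Z):
its hypotheses are this route's items and its conclusion the sub-problem Statement (glue_lint), and it elaborates with this file. -/

@[closes "route-SmoothPoincare4-WeakReductionDescent"] theorem closes (hX1 : DependentTripleAtThree) (hXF : DependentTripleGenusThreeStandard)
    (hX2 : MinimalWeaklyReducibleFromFour) (hG : MinimalWeaklyReducibleOfRungs)
    (h2 : WeakReductionReduces) (h3 : ReducibleSplits)
    (h4 : GenusThreeBase) (h5 : LowGenusBase) (h6 : TrisectionsExist) (h7 : SphereSumSphere) :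
    SmoothPoincare4 := by
  -- rev 4 (route-repair unused-crux, 2026-08-17): crux K1 `MinimalWeaklyReducible` is no longer a
  -- hypothesis — it is DERIVED from its rungs through the glue item `MinimalWeaklyReducibleOfRungs`
  -- (X₁ `DependentTripleAtThree` + X_F `DependentTripleGenusThreeStandard` carry rung 3, X₂
  -- `MinimalWeaklyReducibleFromFour` the rungs ≥ 4); the descent below is rev 1–3's, verbatim.
  have h1 : MinimalWeaklyReducible := hG hX1 hXF hX2
  suffices key : ∀ (g : ℕ) (M : Type) [TopologicalSpace M] [T2Space M] [SecondCountableTopology M]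
      [ChartedSpace (EuclideanSpace ℝ (Fin 4)) M] [IsManifold (𝓡 4) ((⊤ : ℕ∞) : WithTop ℕ∞) M],
      (M ≃ₕ (Metric.sphere (0 : EuclideanSpace ℝ (Fin 5)) 1)) → ∀ (k : Fin 3 → ℕ) (T : Fin 3 → Set M),
      Literature.Topology.FourManifolds.IsGKTrisection M g k T →
      Nonempty (Diffeomorph (𝓡 4) (𝓡 4) M (Metric.sphere (0 : EuclideanSpace ℝ (Fin 5)) 1) ((⊤ : ℕ∞) : WithTop ℕ∞)) by
    unfold SmoothPoincare4 Literature.SPC4.SmoothPoincareConjectureFour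
      ContinuousMap.HomotopyEquiv.NonemptyDiffeomorphSphere
    intro M _ _ _ _ _ e
    obtain ⟨g, k, T, hT⟩ := h6 M e
    exact key g M e k T hT
  intro g
  induction g using Nat.strong_induction_on with
  | _ g IH =>
    intro M _ _ _ _ _ e k T hT
    by_cases hmin : ∀ (g' : ℕ) (k' : Fin 3 → ℕ) (T' : Fin 3 → Set M), Literature.Topology.FourManifolds.IsGKTrisection M g' k' T' → g ≤ g'
    · rcases Nat.lt_or_ge g 3 with hlt | hge
      · exact h5 M e g k T hT (by omega)
      · have hwr := h1 M e g k T hT hge hmin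
        rcases Nat.lt_or_ge g 4 with hlt4 | hge4
        · obtain rfl : g = 3 := by omega
          exact h4 M e k T hT hwr
        · have hred := h2 M e g k T hT hge4 hmin hwr
          obtain ⟨A, _, _, _, _, _, eA, B, _, _, _, _, _, eB, ga, gb, ka, kb, TA, TB, hA, hB, hga, hgb, hsum⟩ :=
            h3 M e g k T hT hred
          exact h7 A B M hsum (IH ga hga A eA ka TA hA) (IH gb hgb B eB kb TB hB)
    · push Not at hmin
      obtain ⟨g', k', T', hT', hlt⟩ := hmin
      exact IH g' hlt M e k' T' hT'

end Summit.SmoothPoincare4.SmoothPoincare4.Theses.WeakReductionDescent
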